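import Summits.NavierStokesRegularity.FluidComputer.ClayBlowupForcedGradientRate
import Summits.NavierStokesRegularity.FluidComputer.ClayBlowupForcedLeraySupRate
import Summits.NavierStokesRegularity.FluidComputer.DesignedBlowupClayBridge
import HarnessLib

/-!
# THE FORCED STRAIN / GRADIENT / CLOCK ROWS ON THE TOWER INTERFACE: Beirão da Veiga, the sub-self-similar
# gradient rate, Miller's middle eigenvalue and Leray's clean clock near `T` — for every `Realisation ν R`

Cell `ns-blowup`, seat `ns-blowup-ecbridge-2` (g9; the E–C endpoint theory seat). LABEL: E–C typing
(KERNEL — no named fact). WHAT THIS IS NOT: not Navier–Stokes evidence — necessary conditions on the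
TYPE `PalasekTowerClayBridge.Realisation ν R` (ecbridge-1's tower interface); `PalasekStep2 R` (the
interface is inhabited) is NOT asserted. Companion of `PalasekTowerRealisationForcedRows` (BKM, the BKM
floor, Constantin–Fefferman, Leray's countdown against the Palasek clock). Companion memo:
`run/shared/lean/pub/ns-blowup/ecbridge2/ECBRIDGE-2-MEMO-8.md`.

* `Realisation.gradient_not_memLqLp` — `∇u ∉ L^q_t L^r_x((0,T) × ℝ³)`, `1 < q < ∞`, `2/q + 3/r = 2`,
  WITH the tower's force (Beirão da Veiga);
* `Realisation.not_subGradientRate` — no `‖∇u(t)‖_{L^r} ≤ C (T − t)^{−γ}` with `γ < 1 − 3/(2r)`,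
  `3/2 < r < ∞`;
* `Realisation.middleEigenvalue_not_integrable` — no nonnegative two-frame majorant of the middle
  principal strain lies in `L^{2q/(2q−3)}_t L^q_x`, `q > 3/2` (Miller);
* `Realisation.leray_rate_sup_near` — `√(c ν/(T − t)) ≤ ‖u(t)‖_∞` on a final stretch `[t₁, T)`
  (Leray's clock in clean form, the force absorbed).

References: Berselli–Galdi 2002 (1.3) [cite: BerselliGaldi2002, (1.3) p. 3586]; Miller 2020
[cite: Miller2019, Thm 1.1]; Leray 1934 (3.16) [cite: Leray1934, (3.16)]; S. Palasek, arXiv:2605.13827 §4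
[cite: Palasek2026ElementaryModel, §4].
-/

noncomputable section

namespace Summit.NavierStokesRegularity.FluidComputer

open Set MeasureTheory Filter Topology Function Metric
open scoped ENNReal ContDiff NNReal
open Literature.Analysis.FluidPDE
open Summit.NavierStokesRegularity.NavierStokesRegularity

namespace PalasekTowerClayBridge.Realisation

variable {ν : ℝ} {R : TowerRates} (W : Realisation ν R)

/-- **Beirão da Veiga for every tower realisation, WITH its force**: `∇u ∉ L^q_t L^r_x((0,T) × ℝ³)`
whenever `1 < q < ∞`, `2/q + 3/r = 2`. [cite: BerselliGaldi2002, (1.3) p. 3586] -/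
theorem gradient_not_memLqLp (hν : 0 < ν) {q r : ℝ≥0∞} (h1q : 1 < q) (hq : q < ⊤)
    (hqr : 2 / q + 3 / r = 2) :
    ¬ MemLqLp q r (fun t x => fderiv ℝ (W.u t) x) (Ioo 0 W.T) :=
  W.toDesignedBlowup.toClayBlowup.gradient_not_memLqLp_forced hν h1q hq hqr

/-- **No sub-self-similar gradient rate for any tower realisation**: no `‖∇u(t)‖_{L^r} ≤ C (T − t)^{−γ}`
on `(0, T)` with `γ < 1 − 3/(2 r.toReal)`, `3/2 < r < ∞`. [cite: BerselliGaldi2002, (1.3) p. 3586]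
[cite: Leray1934, (3.16)] -/
theorem not_subGradientRate (hν : 0 < ν) {r : ℝ≥0∞} (hr : 3 / 2 < r) (hrtop : r ≠ ⊤) {C γ : ℝ}
    (hC : 0 ≤ C) (hγ : γ < 1 - 3 / (2 * r.toReal))
    (hrate : ∀ t ∈ Ioo 0 W.T,
      eLpNorm (fderiv ℝ (W.u t)) r volume ≤ ENNReal.ofReal (C * (W.T - t) ^ (-γ))) : False :=
  W.toDesignedBlowup.toClayBlowup.not_subGradientRate hν hr hrtop hC hγ hrate

/-- **Miller's middle-eigenvalue criterion for every tower realisation, WITH its force**: no nonnegative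
two-frame majorant `m` of the middle principal strain on `[0, T) × ℝ³` has
`∫₀ᵀ (∫ m^q)^{2/(2q−3)} < ∞`, `q > 3/2`. [cite: Miller2019, Thm 1.1] -/
theorem middleEigenvalue_not_integrable (hν : 0 < ν) {q : ℝ} (hq : 3 / 2 < q)
    {m : ℝ → EuclideanSpace ℝ (Fin 3) → ℝ} (hm0 : ∀ t x, 0 ≤ m t x)
    (hdom : ∀ t ∈ Ico 0 W.T, ∀ x, ∃ v w : EuclideanSpace ℝ (Fin 3),
      ‖v‖ = 1 ∧ ‖w‖ = 1 ∧ inner ℝ v w = 0 ∧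
        ∀ α β : ℝ, inner ℝ (fderiv ℝ (W.u t) x (α • v + β • w)) (α • v + β • w)
          ≤ m t x * (α ^ 2 + β ^ 2)) :
    ¬ (∫⁻ t in Ioo 0 W.T, (∫⁻ x, ENNReal.ofReal (m t x) ^ q) ^ (2 / (2 * q - 3)) < ⊤) :=
  W.toDesignedBlowup.toClayBlowup.middleEigenvalue_not_integrable_forced hν hq hm0 hdom

/-- **Leray's clock in clean form on a final stretch, for every tower realisation**: there are `c > 0`
and `t₁ < T` with `√(c ν / (T − t)) ≤ ‖u(t)‖_{L^∞}` for all `t ∈ [t₁, T) ∩ [0, T)` (the tower's force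
absorbed into the constant near `T`). [cite: Leray1934, (3.16)] [cite: Palasek2026ElementaryModel, §4] -/
theorem leray_rate_sup_near (hν : 0 < ν) :
    ∃ c : ℝ, 0 < c ∧ ∃ t₁ : ℝ, t₁ < W.T ∧ ∀ t ∈ Ico 0 W.T, t₁ ≤ t →
      ENNReal.ofReal (Real.sqrt (c * ν / (W.T - t))) ≤ eLpNorm (W.u t) ⊤ volume :=
  W.toDesignedBlowup.toClayBlowup.forced_leray_rate_sup_near hν

end PalasekTowerClayBridge.Realisation

end Summit.NavierStokesRegularity.FluidComputer

end
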